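import Summits.BirchSwinnertonDyer.BirchSwinnertonDyer.Theorems.ErratumRoadFiveNonSurjCornerShapeFive
import HarnessLib

/-!
# Route `ErratumRoadFive` (rung K2), crux `NonSurjCorner` (item stmt-BirchSwinnertonDyer-19065):
# THE IMAGE OF A CORNER PAIR IS THE FULL NORMALISER OF A SPLIT CARTAN SUBGROUP — hence `−1 ∈ ρ̄_{E,p}(Γ_ℚ)`
# at every pair of the `p = 7` branch (input (ii) «`−1 ∈ ρ̄_{E,7}(Γ_ℚ)`» of lane A's reading of `stub_kolyJ_max`,
# crux child 19947, DISCHARGED class-wide)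
# (cell `bsd-stepL`, seat `bsd-stepL-corner5-p2` g2, WIDTH-LEVER lane B; `--supports stmt-BirchSwinnertonDyer-19065 --as helper`)

WHY THIS FILE. The siblings `ErratumRoadFiveNonSurjCornerShape{,Five}.lean` give, for every pair with
`Mult W p ∧ Irr W p ∧ ¬Surj W p` and `p ≥ 7` (or `p = 5` with `3 ∤ #G`), a frame `P` with
`P (1 0; 0 *) P⁻¹ ≤ G ≤ N(C)`, `G ⊄ C`, `C = P (* 0; 0 *) P⁻¹`. One more line of group theory pins the
image EXACTLY: an element `w ∈ G ∖ C` swaps the two lines, so it conjugates the inertia half-Cartan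
`P (1 0; 0 *) P⁻¹` onto the OTHER half-Cartan `P (* 0; 0 1) P⁻¹`; the two half-Cartans generate `C`, so
`C ≤ G`, and `[N(C) : C] = 2` forces **`G = N(C)`** (order `2(p−1)²`: `72` at `p = 7`, `32` at `p = 5` —
Sutherland's labels `7Ns`, `5Ns` are the FULL normalisers). In particular the scalar `−1 ∈ C ≤ G`:
**some `γ ∈ Γ_ℚ` acts as `−P` on all of `E[p]`.** At `p = 7` this is input (ii) of lane A's (corner-p1 g9)
reading `nonSurjCornerKolyJ_max_of_levelOneSupply_of_perLevel` of the registered stub `stub_kolyJ_max`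
(`p = 7 → ∃ γ, ∀ P : E[p], γ • P = −P`), recorded there as «genuine» and «not by group theory» — it IS by
group theory once multiplicative reduction at `p` (the inertia half-Cartan) is used; at `p = 5` lane A's
`exists_smul_eq_neg_five_of_irr_of_not_surj` already covers every irreducible non-surjective image.

* §1 (group theory, any field with `|F| ≥ 3`) `splitCartan_le_of_halfSplitCartan_le`,
  `eq_normalizer_splitCartan_of_halfSplitCartan_le`, `neg_one_mem_splitCartan`.
* §2 (frame) `image_eq_normalizer_splitCartan` (`p ≥ 7`), `image_eq_normalizer_splitCartan_of_not_three_dvd`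
  (`p ≥ 5`, `3 ∤ #G`), `exists_apply_eq_neg_one`, `exists_smul_eq_neg_of_mult_of_irr_of_not_surj`
  (frame-free: `∃ γ, ∀ P ∈ E[p], γ • P = −P`, `p ≥ 7`).
* §3 `NonSurjCorner.exists_smul_eq_neg_seven` — at the crux's `p = 7` hypotheses, in the exact shape of
  lane A's input (ii).

HONEST FRAMING: structure theorems about Galois images; nothing here proves the crux, a registered stub, or
BSD for any class; nothing is booked; no definition, no named fact, no `sorry`.

References: [Serre1972] §2.1 a), §2.2 (`(N : C) = 2`), §2.7 Prop. 17, §5.4; tree files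
`ErratumRoadFiveNonSurjCornerShape{,Five}`, `GaloisImage/MultiplicativeCartanNormalizer`,
`SerreCartanNormalizerGL2Fp` (`mem_normalizer_splitCartan_iff`), `ProjectiveTypeSolvable` (`GL2.IsAd.mul_diagonal`).
-/
set_option linter.dupNamespace false -- `Summit.BirchSwinnertonDyer.BirchSwinnertonDyer` (summit = problem), tree-wide
noncomputable section
open scoped Classical NumberField
open IsDedekindDomain Field Matrix

namespace Summit.BirchSwinnertonDyer.BirchSwinnertonDyer.Theorems.CornerShape

open WeierstrassCurve NumberField Rat.HeightOneSpectrum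
  Literature.NumberTheory.EllipticCurves Literature.NumberTheory.GaloisRepresentations
  Literature.NumberTheory.GaloisRepresentations.Serre1972
  Literature.NumberTheory.EllipticCurves.Rank1Residual
  Summit.BirchSwinnertonDyer.Rank1Residual Summit.BirchSwinnertonDyer.Rank1Residual.GaloisImage

/-! ### §1. Group theory: a subgroup of `N(C)` containing a split half-Cartan and meeting `N ∖ C` is `N(C)` -/

section GroupTheory

variable {F : Type*} [Field F]

/-- **The swapped half-Cartan.** If `Q = P⁻¹ w P` is antidiagonal then `Q diag(1,u) Q⁻¹ = diag(u,1)`: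
conjugating by an element of `N(C) ∖ C` swaps the two half-Cartan subgroups of `C` (n° 2.1 a), 2.2).
[cite: Serre1972, §2.2] -/
theorem coe_conj_halfDiagonalHom_of_isAd {Q : GL (Fin 2) F}
    (hQ : GL2.IsAd ((Q : GL (Fin 2) F) : Matrix (Fin 2) (Fin 2) F)) (u : Fˣ) :
    ((Q * halfDiagonalHom u * Q⁻¹ : GL (Fin 2) F) : Matrix (Fin 2) (Fin 2) F) =
      diagonal ![(u : F), 1] := by
  have h : ((Q * halfDiagonalHom u : GL (Fin 2) F) : Matrix (Fin 2) (Fin 2) F) =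
      diagonal ![(u : F), 1] * (Q : Matrix (Fin 2) (Fin 2) F) := by
    rw [Units.val_mul, coe_halfDiagonalHom, hQ.mul_diagonal]
    simp
  rw [Units.val_mul, h, Matrix.mul_assoc, ← Units.val_mul, mul_inv_cancel, Units.val_one, Matrix.mul_one]

/-- **`P (1 0; 0 *) P⁻¹ ≤ G ≤ N(C)`, `G ⊄ C` ⟹ `C ≤ G`** (`C = P (* 0; 0 *) P⁻¹`, `|F| ≥ 3`): an element
`w ∈ G ∖ C` is antidiagonal in the frame `P` (`mem_normalizer_splitCartan_iff`), it conjugates `P diag(1,a) P⁻¹`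
to `P diag(a,1) P⁻¹ ∈ G`, and `diag(a,b) = diag(a,1)·diag(1,b)`. [cite: Serre1972, §2.1 a) and §2.2] -/
theorem splitCartan_le_of_halfSplitCartan_le (hF : ∃ u : Fˣ, u ≠ 1) {G : Subgroup (GL (Fin 2) F)}
    {P : GL (Fin 2) F} (hCG : halfSplitCartan P ≤ G)
    (hGN : G ≤ Subgroup.normalizer (splitCartan P : Set (GL (Fin 2) F))) (hGC : ¬ G ≤ splitCartan P) :
    splitCartan P ≤ G := by
  -- an element `w ∈ G ∖ C`, antidiagonal in the frame `P`
  obtain ⟨w, hwG, hwC⟩ : ∃ w ∈ G, w ∉ splitCartan P := by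
    by_contra! h; exact hGC h
  have hwad : GL2.IsAd ((P⁻¹ * w * P : GL (Fin 2) F) : Matrix (Fin 2) (Fin 2) F) := by
    rcases (mem_normalizer_splitCartan_iff hF).mp (hGN hwG) with hdg | had
    · exact absurd (mem_splitCartan_iff.mpr hdg) hwC
    · exact had
  -- the half-Cartan elements `d_u = P diag(1,u) P⁻¹ ∈ G`
  have hd : ∀ u : Fˣ, P * halfDiagonalHom u * P⁻¹ ∈ G := fun u ↦
    hCG ⟨halfDiagonalHom u, by rw [← range_halfDiagonalHom]; exact ⟨u, rfl⟩, by
      rw [MulEquiv.coe_toMonoidHom, MulAut.conj_apply]⟩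
  intro g hg
  have hdg : GL2.IsDg ((P⁻¹ * g * P : GL (Fin 2) F) : Matrix (Fin 2) (Fin 2) F) :=
    mem_splitCartan_iff.mp hg
  obtain ⟨ha0, hb0⟩ := hdg.entry_ne_zero (GL2.det_ne_zero _)
  set a : Fˣ := Units.mk0 _ ha0 with ha
  set b : Fˣ := Units.mk0 _ hb0 with hb
  set Q : GL (Fin 2) F := P⁻¹ * w * P with hQ
  -- `P⁻¹ g P = (Q diag(1,a) Q⁻¹) · diag(1,b)`
  have hmat : ((P⁻¹ * g * P : GL (Fin 2) F) : Matrix (Fin 2) (Fin 2) F) =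
      ((Q * halfDiagonalHom a * Q⁻¹ : GL (Fin 2) F) : Matrix (Fin 2) (Fin 2) F) *
        ((halfDiagonalHom b : GL (Fin 2) F) : Matrix (Fin 2) (Fin 2) F) := by
    rw [coe_conj_halfDiagonalHom_of_isAd hwad, coe_halfDiagonalHom, diagonal_mul_diagonal,
      hdg.eq_diagonal]
    congr 1
    ext i
    fin_cases i <;> simp [ha, hb]
  have hkey : (P⁻¹ * g * P : GL (Fin 2) F) = Q * halfDiagonalHom a * Q⁻¹ * halfDiagonalHom b :=
    Units.ext (by rw [hmat, ← Units.val_mul])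
  have hg' : g = w * (P * halfDiagonalHom a * P⁻¹) * w⁻¹ * (P * halfDiagonalHom b * P⁻¹) := by
    have : g = P * (P⁻¹ * g * P) * P⁻¹ := by group
    rw [this, hkey, hQ]; group
  rw [hg']
  exact G.mul_mem (G.mul_mem (G.mul_mem hwG (hd a)) (G.inv_mem hwG)) (hd b)

/-- **`P (1 0; 0 *) P⁻¹ ≤ G ≤ N(C)`, `G ⊄ C` ⟹ `G = N(C)`**: `C ≤ G` by `splitCartan_le_of_halfSplitCartan_le`,
and `N = C ∪ wC` for any `w ∈ N ∖ C` (the product of two antidiagonal matrices is diagonal), so `N ≤ G`.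
[cite: Serre1972, §2.2] -/
theorem eq_normalizer_splitCartan_of_halfSplitCartan_le (hF : ∃ u : Fˣ, u ≠ 1)
    {G : Subgroup (GL (Fin 2) F)} {P : GL (Fin 2) F} (hCG : halfSplitCartan P ≤ G)
    (hGN : G ≤ Subgroup.normalizer (splitCartan P : Set (GL (Fin 2) F))) (hGC : ¬ G ≤ splitCartan P) :
    G = Subgroup.normalizer (splitCartan P : Set (GL (Fin 2) F)) := by
  have hCle : splitCartan P ≤ G := splitCartan_le_of_halfSplitCartan_le hF hCG hGN hGC
  refine le_antisymm hGN fun n hn ↦ ?_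
  obtain ⟨w, hwG, hwC⟩ : ∃ w ∈ G, w ∉ splitCartan P := by
    by_contra! h; exact hGC h
  have hwad : GL2.IsAd ((P⁻¹ * w * P : GL (Fin 2) F) : Matrix (Fin 2) (Fin 2) F) := by
    rcases (mem_normalizer_splitCartan_iff hF).mp (hGN hwG) with hdg | had
    · exact absurd (mem_splitCartan_iff.mpr hdg) hwC
    · exact had
  rcases (mem_normalizer_splitCartan_iff hF).mp hn with hdg | had
  · exact hCle (mem_splitCartan_iff.mpr hdg)
  · -- `n w ∈ C`, so `n = (n w) w⁻¹ ∈ G`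
    have hnw : n * w ∈ splitCartan P := by
      refine mem_splitCartan_iff.mpr ?_
      have : (P⁻¹ * (n * w) * P : GL (Fin 2) F) = (P⁻¹ * n * P) * (P⁻¹ * w * P) := by group
      rw [this, Units.val_mul]
      exact had.mul hwad
    have : n = (n * w) * w⁻¹ := by group
    rw [this]
    exact G.mul_mem (hCle hnw) (G.inv_mem hwG)

/-- The scalar `−1` lies in every split Cartan subgroup. [folklore] -/
theorem neg_one_mem_splitCartan (P : GL (Fin 2) F) : -1 ∈ splitCartan P := by
  refine mem_splitCartan_iff.mpr ?_
  have : (P⁻¹ * -1 * P : GL (Fin 2) F) = -1 := by rw [mul_neg, mul_one, neg_mul, inv_mul_cancel]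
  rw [this, Units.val_neg, Units.val_one]
  exact ⟨by simp, by simp⟩

end GroupTheory

/-! ### §2. The image of a corner pair is the full normaliser; `−1` is in the image -/

variable (W : WeierstrassCurve ℚ) [W.IsElliptic] (p : ℕ) [hp : Fact p.Prime]

section Frame

variable (Φ : Multiplicative (AddAut (geomTorsion W p)) ≃* GL (Fin 2) (ZMod p))
  (e : geomTorsion W p ≃+ (Fin 2 → ZMod p))
  (he : ∀ (g : Multiplicative (AddAut (geomTorsion W p))) (x : geomTorsion W p),
    e (Multiplicative.toAdd g x) =
      ((Φ g : GL (Fin 2) (ZMod p)) : Matrix (Fin 2) (Fin 2) (ZMod p)) *ᵥ e x)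

include he

/-- **THE IMAGE OF A `p ≥ 7` CORNER PAIR IS THE FULL NORMALISER OF A SPLIT CARTAN SUBGROUP**: for `W/ℚ`
elliptic, `p ≥ 7` multiplicative, `E[p]` irreducible, `ρ̄_{E,p}` not onto, and a frame `Φ`:
`Φ(ρ̄(Γ_ℚ)) = N(P (* 0; 0 *) P⁻¹)` for some `P` — a group of order `2(p−1)²` (Sutherland's `pNs`).
[cite: Serre1972, §2.2 and §2.7 Prop. 17] [cite: Zywina2015, Thm. 1.5 (ℓ = 7: `G₂ = N_s(7)`)] -/
theorem image_eq_normalizer_splitCartan (hp7 : 7 ≤ p) (hmult : Mult W p) (hirr : Irr W p)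
    (hns : ¬ Surj W p) :
    ∃ P : GL (Fin 2) (ZMod p), (galoisRepTorsion W p).range.map Φ.toMonoidHom =
      Subgroup.normalizer (splitCartan P : Set (GL (Fin 2) (ZMod p))) := by
  obtain ⟨P, hCG, hGN, hGC⟩ :=
    GaloisImage.exists_le_normalizer_splitCartan_of_mult_of_irr_of_not_surj W p Φ e he hp7 hmult hirr hns
  exact ⟨P, eq_normalizer_splitCartan_of_halfSplitCartan_le (exists_units_ne_one (by omega)) hCG hGN hGC⟩

/-- **The same at `p ≥ 5` off the octahedral image (`3 ∤ #G`)**: `Φ(ρ̄(Γ_ℚ)) = N(P (* 0; 0 *) P⁻¹)`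
(at `p = 5`: the `5Ns` sub-corner has image EXACTLY the normaliser, of order `32`). [cite: Serre1972, §2.2, §2.6, §2.7] -/
theorem image_eq_normalizer_splitCartan_of_not_three_dvd (h5 : 5 ≤ p) (hmult : Mult W p)
    (hirr : Irr W p) (hns : ¬ Surj W p)
    (h3 : ¬ 3 ∣ Nat.card ((galoisRepTorsion W p).range.map Φ.toMonoidHom)) :
    ∃ P : GL (Fin 2) (ZMod p), (galoisRepTorsion W p).range.map Φ.toMonoidHom =
      Subgroup.normalizer (splitCartan P : Set (GL (Fin 2) (ZMod p))) := by
  obtain ⟨P, hCG, hGN, hGC, -⟩ :=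
    exists_splitCartan_normalizer_of_not_three_dvd W p Φ e he h5 hmult hirr hns h3
  exact ⟨P, eq_normalizer_splitCartan_of_halfSplitCartan_le (exists_units_ne_one (by omega)) hCG hGN hGC⟩

omit [W.IsElliptic] he in
/-- **From `−1 ∈ Φ(ρ̄(Γ_ℚ))` to the Galois action**: if `Φ(ρ̄ γ) = −1` then `γ • P = −P` on `E[p]`
(frame compatibility `e(g x) = Φ(g) e(x)`). [folklore] -/
theorem smul_eq_neg_of_apply_eq_neg_one
    (he : ∀ (g : Multiplicative (AddAut (geomTorsion W p))) (x : geomTorsion W p),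
      e (Multiplicative.toAdd g x) =
        ((Φ g : GL (Fin 2) (ZMod p)) : Matrix (Fin 2) (Fin 2) (ZMod p)) *ᵥ e x)
    {γ : absoluteGaloisGroup ℚ} (hγ : Φ (galoisRepTorsion W p γ) = -1) (x : geomTorsion W p) :
    γ • x = -x := by
  apply e.injective
  have h1 : γ • x = Multiplicative.toAdd (galoisRepTorsion W p γ) x := rfl
  rw [h1, he, hγ, Units.val_neg, Units.val_one, Matrix.neg_mulVec, Matrix.one_mulVec, map_neg]

/-- **`−1 ∈ ρ̄_{E,p}(Γ_ℚ)` at every `p ≥ 7` corner pair, framed**: some `γ ∈ Γ_ℚ` has `Φ(ρ̄ γ) = −1`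
(`−1 ∈ C ≤ N(C) = G`). [cite: Serre1972, §2.2] -/
theorem exists_apply_eq_neg_one (hp7 : 7 ≤ p) (hmult : Mult W p) (hirr : Irr W p) (hns : ¬ Surj W p) :
    ∃ γ : absoluteGaloisGroup ℚ, Φ (galoisRepTorsion W p γ) = -1 := by
  obtain ⟨P, hG⟩ := image_eq_normalizer_splitCartan W p Φ e he hp7 hmult hirr hns
  have hmem : (-1 : GL (Fin 2) (ZMod p)) ∈ (galoisRepTorsion W p).range.map Φ.toMonoidHom := by
    rw [hG]; exact Subgroup.le_normalizer (neg_one_mem_splitCartan P)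
  obtain ⟨γ, hγ⟩ := (mem_map_range_galoisRepTorsion_iff W p Φ).mp hmem
  exact ⟨γ, hγ⟩

end Frame

/-- **`−1 ∈ ρ̄_{E,p}(Γ_ℚ)` at every `p ≥ 7` corner pair, frame-free**: for `W/ℚ` elliptic with
multiplicative reduction at `p ≥ 7`, `E[p]` irreducible and `ρ̄_{E,p}` not onto, some `γ ∈ Γ_ℚ` acts as
`−1` on `E[p]`. The `p = 7` case is input (ii) of lane A's reading of `stub_kolyJ_max` (crux child 19947).
[cite: Serre1972, §2.2 and §2.7 Prop. 17] -/
theorem exists_smul_eq_neg_of_mult_of_irr_of_not_surj (hp7 : 7 ≤ p) (hmult : Mult W p)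
    (hirr : Irr W p) (hns : ¬ Surj W p) :
    ∃ γ : absoluteGaloisGroup ℚ, ∀ x : geomTorsion W p, γ • x = -x := by
  obtain ⟨e, Φ, he, -⟩ := exists_frame_galoisRepTorsion_rat W p
  obtain ⟨γ, hγ⟩ := exists_apply_eq_neg_one W p Φ e he hp7 hmult hirr hns
  exact ⟨γ, smul_eq_neg_of_apply_eq_neg_one W p Φ e he hγ⟩

/-- **`−1 ∈ ρ̄_{E,p}(Γ_ℚ)` off the octahedral image at `p ≥ 5`** (`3 ∤ #G` in some, equivalently every,
frame — the cardinality of the image does not depend on the frame, but the hypothesis is stated for the frame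
produced by `exists_frame_galoisRepTorsion_rat` via an arbitrary-frame quantifier). [cite: Serre1972, §2.2, §2.6] -/
theorem exists_smul_eq_neg_of_not_three_dvd (h5 : 5 ≤ p) (hmult : Mult W p) (hirr : Irr W p)
    (hns : ¬ Surj W p)
    (h3 : ∀ (Φ : Multiplicative (AddAut (geomTorsion W p)) ≃* GL (Fin 2) (ZMod p)),
      ¬ 3 ∣ Nat.card ((galoisRepTorsion W p).range.map Φ.toMonoidHom)) :
    ∃ γ : absoluteGaloisGroup ℚ, ∀ x : geomTorsion W p, γ • x = -x := by
  obtain ⟨e, Φ, he, -⟩ := exists_frame_galoisRepTorsion_rat W p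
  obtain ⟨P, hG⟩ := image_eq_normalizer_splitCartan_of_not_three_dvd W p Φ e he h5 hmult hirr hns (h3 Φ)
  have hmem : (-1 : GL (Fin 2) (ZMod p)) ∈ (galoisRepTorsion W p).range.map Φ.toMonoidHom := by
    rw [hG]; exact Subgroup.le_normalizer (neg_one_mem_splitCartan P)
  obtain ⟨γ, hγ⟩ := (mem_map_range_galoisRepTorsion_iff W p Φ).mp hmem
  exact ⟨γ, smul_eq_neg_of_apply_eq_neg_one W p Φ e he hγ⟩

/-! ### §3. At the crux's `p = 7` branch: lane A's input (ii) -/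

/-- **Input (ii) of `stub_kolyJ_max`'s reading, DISCHARGED at every pair of the `p = 7` branch of the corner:**
for `W/ℚ` globally minimal with `ClassX11b W 7` and `¬ Surj W 7`, some `γ ∈ Γ_ℚ` acts as `−1` on `E[7]`
(the image is the full normaliser of a split Cartan subgroup of `GL₂(𝔽₇)`, of order `72`, which contains the
scalar `−1`). Same shape as lane A's `exists_smul_eq_neg_five_of_irr_of_not_surj` at `p = 5`; here the
multiplicative reduction at `7` (binder of `ClassX11b`) is USED — a general irreducible non-surjective subgroup
of `GL₂(𝔽₇)` need not contain `−1`. [cite: Serre1972, §2.2 and §2.7 Prop. 17] [cite: Zywina2015, Thm. 1.5 (ℓ = 7)] -/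
theorem NonSurjCorner.exists_smul_eq_neg_seven (W : WeierstrassCurve ℚ) [W.IsElliptic] [W.IsGloballyMinimal]
    [Fact (Nat.Prime 7)] (hX : ClassX11b W 7) (hns : ¬ Surj W 7) :
    ∃ γ : absoluteGaloisGroup ℚ, ∀ P : geomTorsion W ((7 : ℕ) : ℤ), γ • P = -P :=
  exists_smul_eq_neg_of_mult_of_irr_of_not_surj W 7 (le_refl 7) hX.2.2.1 hX.2.2.2 hns

/-! ### §4. Over the Cartan field: the image of `U` is the WHOLE split Cartan subgroup (appended) -/

section FrameU

variable (Φ : Multiplicative (AddAut (geomTorsion W p)) ≃* GL (Fin 2) (ZMod p))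
  (e : geomTorsion W p ≃+ (Fin 2 → ZMod p))
  (he : ∀ (g : Multiplicative (AddAut (geomTorsion W p))) (x : geomTorsion W p),
    e (Multiplicative.toAdd g x) =
      ((Φ g : GL (Fin 2) (ZMod p)) : Matrix (Fin 2) (Fin 2) (ZMod p)) *ᵥ e x)

omit [W.IsElliptic] in
/-- **The image of the Cartan subgroup `U = ρ̄⁻¹(Φ⁻¹(C))` is ALL of `C`** as soon as `C ≤ G` (which
`image_eq_normalizer_splitCartan{,_of_not_three_dvd}` gives at every Cartan-type corner pair): over the
quadratic Cartan field `K`, `ρ̄_{E,p}(Γ_K) = C ≅ 𝔽_pˣ × 𝔽_pˣ` — the two isogeny characters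
`χ̄₁, χ̄₂ : Γ_K → 𝔽_pˣ` of `E/K` are JOINTLY onto (in particular `χ̄₁ ≠ χ̄₂`, `χ̄₁ ≠ χ̄₂^{±1}ω^{0}` unless
forced, and each `χ̄ᵢ` is onto). [cite: Serre1972, §2.1 a) and §2.2] -/
theorem map_cartanSubgroup_eq_splitCartan {P : GL (Fin 2) (ZMod p)}
    (hCle : splitCartan P ≤ (galoisRepTorsion W p).range.map Φ.toMonoidHom) :
    ((((splitCartan P).comap Φ.toMonoidHom).comap (galoisRepTorsion W p)).map
        (galoisRepTorsion W p)).map Φ.toMonoidHom = splitCartan P := by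
  refine le_antisymm ?_ fun c hc ↦ ?_
  · rintro x ⟨y, ⟨σ, hσ, rfl⟩, rfl⟩
    exact (mem_comap_cartan_iff W p Φ).mp hσ
  · obtain ⟨σ, hσ⟩ := (mem_map_range_galoisRepTorsion_iff W p Φ).mp (hCle hc)
    exact ⟨galoisRepTorsion W p σ, ⟨σ, (mem_comap_cartan_iff W p Φ).mpr (hσ ▸ hc), rfl⟩, hσ⟩

include he in
/-- **Jointly onto, in coordinates**: at a `p ≥ 7` corner pair, for every pair of units `(a, b)` some
`σ ∈ Γ_ℚ` lies in `U` and acts on the line `e⁻¹(𝔽_p · P e₀)` by `a` and on `e⁻¹(𝔽_p · P e₁)` by `b`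
(`Φ(ρ̄ σ) = P diag(a,b) P⁻¹`). [cite: Serre1972, §2.1 a)] -/
theorem exists_mem_cartanSubgroup_apply_eq_conj_diagonal (hp7 : 7 ≤ p) (hmult : Mult W p)
    (hirr : Irr W p) (hns : ¬ Surj W p) :
    ∃ P : GL (Fin 2) (ZMod p),
      (galoisRepTorsion W p).range.map Φ.toMonoidHom =
        Subgroup.normalizer (splitCartan P : Set (GL (Fin 2) (ZMod p))) ∧
      ∀ a b : (ZMod p)ˣ, ∃ σ ∈ ((splitCartan P).comap Φ.toMonoidHom).comap (galoisRepTorsion W p),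
        Φ (galoisRepTorsion W p σ) =
          P * (Matrix.GeneralLinearGroup.scalar (Fin 2) a * halfDiagonalHom (a⁻¹ * b)) * P⁻¹ := by
  obtain ⟨P, hG⟩ := image_eq_normalizer_splitCartan W p Φ e he hp7 hmult hirr hns
  refine ⟨P, hG, fun a b ↦ ?_⟩
  have hd : P * (Matrix.GeneralLinearGroup.scalar (Fin 2) a * halfDiagonalHom (a⁻¹ * b)) * P⁻¹ ∈
      splitCartan P := by
    refine mem_splitCartan_iff.mpr ?_
    have : (P⁻¹ * (P * (Matrix.GeneralLinearGroup.scalar (Fin 2) a * halfDiagonalHom (a⁻¹ * b)) * P⁻¹) *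
        P : GL (Fin 2) (ZMod p)) = Matrix.GeneralLinearGroup.scalar (Fin 2) a * halfDiagonalHom (a⁻¹ * b) := by
      group
    rw [this, Units.val_mul, coe_halfDiagonalHom]
    refine (GL2.IsDg.mul ?_ (GL2.isDg_diagonal _))
    rw [Matrix.GeneralLinearGroup.coe_scalar, Matrix.scalar_apply]
    exact GL2.isDg_diagonal _
  have hCle : splitCartan P ≤ (galoisRepTorsion W p).range.map Φ.toMonoidHom := by
    rw [hG]; exact Subgroup.le_normalizer
  obtain ⟨σ, hσ⟩ := (mem_map_range_galoisRepTorsion_iff W p Φ).mp (hCle hd)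
  exact ⟨σ, (mem_comap_cartan_iff W p Φ).mpr (hσ ▸ hd), hσ⟩

end FrameU

end Summit.BirchSwinnertonDyer.BirchSwinnertonDyer.Theorems.CornerShape

end
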